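import Summits.Parity.BatemanHorn.Theorems.SoloInformedSmoothHyperbolaReduction

/-!
# The typed hypothesis: uniform power savings in shifted Hooley sums

Informed soloist `solo-Parity-informed` (session 142), conjunct `BatemanHorn`, the `d ≥ 3` rung BELOW the parity
wall; sequel to `SoloInformedSmoothHyperbola{,Fourier,Reduction}`.  Those files prove, for `g` irreducible of
degree `d ≥ 3` and any fixed `Δ > 0`,

  `ErdosDivisorSumAsymptotic g ↔ WindowRootEquidistribution g ↔ D_g(x)/(x log x) → 0`,

where `D_g(x) = Mid^w_g(x) − H^w_g(x; E_g(x))` has the EXACT trilinear expansion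
`D_g(x) = ∑_{x<e≤E} ∑_{0<h<e} κ_e(h)·[a_e(x) S^{(x+1)}_g(h;e) − a_e(1) S^{(1)}_g(h;e) − ∑_{m<x} Δa_e(m) S^{(m+1)}_g(h;e)]`
in the SHIFTED HOOLEY SUMS `S^{(b)}_g(h; e) = ∑_{g(ν)≡0 (e)} e(h(ν−b)/e)` (`hooleySumShift`), with
`|κ_e(h)| ≤ 1/(4 min(h, e−h))`, `0 ≤ a_e ≤ 1`, `|Δa_e(m)| ≤ (log|g(m+1)| − log|g(m)|)/(4Δ) ≍ d/(4Δm)`, and `Δa_e(m)`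
supported on `e ∈ (e^{−Δ}√|g(m)|, e^{Δ}√|g(m+1)|]`.

This file TYPES the open content in Hooley's own currency and records the tools for the last step:
* `HooleyShiftUniform g η`: ONE constant `C` with `‖∑_{E<e≤E'} S^{(b)}_g(h; e)‖ ≤ C·E^{1−η}` for all dyadic
  `1 ≤ E ≤ E' ≤ 2E`, all `0 < |h| ≤ E`, all shifts `0 ≤ b ≤ 2E` — a power saving in the MODULUS sum, uniform in the
  frequency and the shift.  Sanity: `η = 0` holds for every irreducible `g` (`hooleyShiftUniform_zero`, Hall–Tenenbaum
  `∑_{e≤y} ρ_g(e) ≪ y`); the family is monotone in `η` (`HooleyShiftUniform.mono`).  Hooley (1964) gives `o(E)` at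
  FIXED `h` (any degree); uniform power savings are known only for `d = 2` (Hooley 1963, Duke–Friedlander–Iwaniec
  1995, Tóth 2000).  Square-root cancellation is `η = 1/2`.
* `sum_Ioc_mul_eq_abel` / `norm_sum_Ioc_mul_le_abel`: Abel summation in the modulus against a weight of bounded
  variation — the step that converts `HooleyShiftUniform` into bounds for the weighted blocks of `D_g`.
* `HooleyShiftTarget g` (a `Prop`, NOT proved here): `∀ η > 1 − 2/d, HooleyShiftUniform g η → WindowRootEquidistribution g`.
  Bookkeeping behind the exponent (informal): after folding `h` to `|h| ≤ e/2` and summing by parts in `e` on the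
  `O(1)` dyadic blocks where `Δa_e(m) ≠ 0` (scale `√|g(m)| ≍ m^{d/2}`), the `m`-terms contribute
  `∑_{m≤x} (1/m)·(m^{d/2})^{1−η}·log m ≍ x^{(d/2)(1−η)} log x`, which is `o(x log x)` iff `η > 1 − 2/d`; the boundary
  term `a_e(x)` contributes the same order.  HONEST RANGE: only `d = 3` (`η > 1/3 < 1/2`) is a meaningful target;
  for `d ≥ 4` the needed `η ≥ 1/2` is at or beyond square-root cancellation in `e` alone.
Nothing here moves a wall row; verdict NO PATH unchanged.
-/

namespace Summit.Parity.BatemanHorn.Theorems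

open Finset Polynomial Filter Topology
open Literature.NumberTheory.Sieve (polyRootCountMod exists_sum_rootCount_le)

/-! ### The hypothesis family -/

/-- **UNIFORM POWER SAVING IN SHIFTED HOOLEY SUMS** with exponent `η`: one constant `C` such that
`‖∑_{E<e≤E'} S^{(b)}_g(h; e)‖ ≤ C·E^{1−η}` for all `1 ≤ E ≤ E' ≤ 2E`, all `h ≠ 0` with `|h| ≤ E`, all `0 ≤ b ≤ 2E`.
A `Prop`; open for every `η > 0` when `deg g ≥ 3`. [this work; after Hooley 1964] -/
def HooleyShiftUniform (g : ℤ[X]) (η : ℝ) : Prop :=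
  ∃ C : ℝ, ∀ (h b : ℤ) (E E' : ℕ), h ≠ 0 → 1 ≤ E → E ≤ E' → E' ≤ 2 * E → |h| ≤ E → 0 ≤ b → b ≤ 2 * E →
    ‖∑ e ∈ Ioc E E', hooleySumShift g e h b‖ ≤ C * (E : ℝ) ^ (1 - η)

/-- Monotonicity: a larger saving implies a smaller one. [this work] -/
theorem HooleyShiftUniform.mono {g : ℤ[X]} {η η' : ℝ} (hle : η' ≤ η) (h : HooleyShiftUniform g η) :
    HooleyShiftUniform g η' := by
  obtain ⟨C, hC⟩ := h
  refine ⟨max C 0, fun h b E E' hh hE hEE' hE' hhE hb hbE => ?_⟩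
  have h1 := hC h b E E' hh hE hEE' hE' hhE hb hbE
  have hE1 : (1 : ℝ) ≤ E := by exact_mod_cast hE
  have h2 : (E : ℝ) ^ (1 - η) ≤ (E : ℝ) ^ (1 - η') :=
    Real.rpow_le_rpow_of_exponent_le hE1 (by linarith)
  have h3 : C * (E : ℝ) ^ (1 - η) ≤ max C 0 * (E : ℝ) ^ (1 - η) :=
    mul_le_mul_of_nonneg_right (le_max_left _ _) (by positivity)
  exact h1.trans (h3.trans (mul_le_mul_of_nonneg_left h2 (le_max_right _ _)))

/-- **Sanity (`η = 0`)**: the trivial bound `‖S^{(b)}_g(h; e)‖ ≤ ρ_g(e)` and Hall–Tenenbaum's `∑_{e≤y} ρ_g(e) ≤ Cy`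
give `HooleyShiftUniform g 0` for every irreducible `g` of positive degree — the normalisation `E^{1−η}` is the
right one. [this work] -/
theorem hooleyShiftUniform_zero {g : ℤ[X]} (hirr : Irreducible g) (hdeg : 0 < g.natDegree) :
    HooleyShiftUniform g 0 := by
  obtain ⟨C, hC0, hC⟩ := exists_sum_rootCount_le hirr hdeg
  refine ⟨2 * C, fun h b E E' _ hE hEE' hE' _ _ _ => ?_⟩
  rw [sub_zero, Real.rpow_one]
  have h2E : (2 : ℝ) ≤ ((2 * E : ℕ) : ℝ) := by push_cast; exact_mod_cast (by omega : 2 ≤ 2 * E)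
  have hsum := hC ((2 * E : ℕ) : ℝ) h2E
  rw [Nat.floor_natCast] at hsum
  calc ‖∑ e ∈ Ioc E E', hooleySumShift g e h b‖
      ≤ ∑ e ∈ Ioc E E', ‖hooleySumShift g e h b‖ := norm_sum_le _ _
    _ ≤ ∑ e ∈ Ioc E E', (polyRootCountMod ![g] e : ℝ) := sum_le_sum fun e _ => norm_hooleySumShift_le g e h b
    _ ≤ ∑ e ∈ Icc 1 (2 * E), (polyRootCountMod ![g] e : ℝ) := by
        refine sum_le_sum_of_subset_of_nonneg (fun e he => ?_) fun _ _ _ => by positivity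
        rw [mem_Ioc] at he
        rw [mem_Icc]
        omega
    _ ≤ C * ((2 * E : ℕ) : ℝ) := hsum
    _ = 2 * C * (E : ℝ) := by push_cast; ring

/-! ### Abel summation in the modulus -/

/-- **Abel summation identity**: with `T(t) = ∑_{E<e≤t} s(e)`,
`∑_{E<e≤E'} W(e)s(e) = W(E')T(E') − ∑_{E≤e<E'} (W(e+1) − W(e))·T(e)`. [folklore] -/
theorem sum_Ioc_mul_eq_abel (W s : ℕ → ℂ) {E E' : ℕ} (hEE' : E ≤ E') :
    ∑ e ∈ Ioc E E', W e * s e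
      = W E' * ∑ e ∈ Ioc E E', s e - ∑ e ∈ Ico E E', (W (e + 1) - W e) * ∑ i ∈ Ioc E e, s i := by
  induction E', hEE' using Nat.le_induction with
  | base => simp
  | succ k hk ih =>
      rw [sum_Ioc_succ_top hk, sum_Ioc_succ_top hk, sum_Ico_succ_top hk, ih]
      ring

/-- **Abel summation inequality**: if `‖∑_{E<e≤t} s(e)‖ ≤ M` for all `E ≤ t ≤ E'` then
`‖∑_{E<e≤E'} W(e)s(e)‖ ≤ (‖W(E')‖ + ∑_{E≤e<E'} ‖W(e+1) − W(e)‖)·M` — the total variation of the weight times the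
best block bound. [folklore] -/
theorem norm_sum_Ioc_mul_le_abel (W s : ℕ → ℂ) {E E' : ℕ} (hEE' : E ≤ E') {M : ℝ}
    (hM : ∀ t ∈ Icc E E', ‖∑ e ∈ Ioc E t, s e‖ ≤ M) :
    ‖∑ e ∈ Ioc E E', W e * s e‖ ≤ (‖W E'‖ + ∑ e ∈ Ico E E', ‖W (e + 1) - W e‖) * M := by
  have hM0 : 0 ≤ M := le_trans (norm_nonneg _) (hM E (mem_Icc.mpr ⟨le_rfl, hEE'⟩))
  rw [sum_Ioc_mul_eq_abel W s hEE', add_mul, sum_mul]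
  refine (norm_sub_le _ _).trans (add_le_add ?_ ?_)
  · rw [norm_mul]
    exact mul_le_mul_of_nonneg_left (hM E' (mem_Icc.mpr ⟨hEE', le_rfl⟩)) (norm_nonneg _)
  · refine (norm_sum_le _ _).trans (sum_le_sum fun e he => ?_)
    rw [mem_Ico] at he
    rw [norm_mul]
    exact mul_le_mul_of_nonneg_left (hM e (mem_Icc.mpr ⟨he.1, he.2.le⟩)) (norm_nonneg _)

/-- **A block of the trilinear form under the hypothesis**: if the shifted Hooley sums save `E^{1−η}` on dyadic
blocks, then against any complex weight `W` on `(E, E'] ⊆ (E, 2E]`,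
`‖∑_{E<e≤E'} W(e)·S^{(b)}_g(h; e)‖ ≤ (‖W(E')‖ + ∑_{E≤e<E'} ‖W(e+1) − W(e)‖)·C·E^{1−η}`. [this work] -/
theorem norm_sum_weight_mul_hooleySumShift_le {g : ℤ[X]} {η C : ℝ}
    (hC : ∀ (h b : ℤ) (E E' : ℕ), h ≠ 0 → 1 ≤ E → E ≤ E' → E' ≤ 2 * E → |h| ≤ E → 0 ≤ b → b ≤ 2 * E →
      ‖∑ e ∈ Ioc E E', hooleySumShift g e h b‖ ≤ C * (E : ℝ) ^ (1 - η))
    (W : ℕ → ℂ) {h b : ℤ} {E E' : ℕ} (hh : h ≠ 0) (hE : 1 ≤ E) (hEE' : E ≤ E') (hE' : E' ≤ 2 * E)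
    (hhE : |h| ≤ E) (hb : 0 ≤ b) (hbE : b ≤ 2 * E) :
    ‖∑ e ∈ Ioc E E', W e * hooleySumShift g e h b‖
      ≤ (‖W E'‖ + ∑ e ∈ Ico E E', ‖W (e + 1) - W e‖) * (C * (E : ℝ) ^ (1 - η)) :=
  norm_sum_Ioc_mul_le_abel W (fun e => hooleySumShift g e h b) hEE' fun t ht =>
    hC h b E t hh hE (mem_Icc.mp ht).1 ((mem_Icc.mp ht).2.trans hE') hhE hb hbE

/-! ### Folding the frequency range -/

/-- **Folding `0 < h < e` to `0 < |h| ≤ e/2`** for an `e`-periodic summand: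
`∑_{0<h<e} F(h) = ∑_{1≤h≤(e−1)/2} F(h) + ∑_{1≤k≤e/2} F(−k)`. [folklore] -/
theorem sum_Ico_eq_sum_fold (F : ℤ → ℂ) {e : ℕ} (hper : ∀ k : ℤ, F (k + e) = F k) :
    ∑ h ∈ Ico 1 e, F h = ∑ h ∈ Icc 1 ((e - 1) / 2), F h + ∑ k ∈ Icc 1 (e / 2), F (-(k : ℤ)) := by
  have hsplit : Ico 1 e = Icc 1 ((e - 1) / 2) ∪ Icc ((e - 1) / 2 + 1) (e - 1) := by
    ext h
    simp only [mem_Ico, mem_union, mem_Icc]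
    omega
  have hdisj : Disjoint (Icc 1 ((e - 1) / 2)) (Icc ((e - 1) / 2 + 1) (e - 1)) := by
    rw [disjoint_left]
    intro h h1 h2
    rw [mem_Icc] at h1 h2
    omega
  rw [hsplit, sum_union hdisj]
  congr 1
  refine sum_nbij' (fun h => e - h) (fun k => e - k) (fun h hh => ?_) (fun k hk => ?_) (fun h hh => ?_)
    (fun k hk => ?_) (fun h hh => ?_)
  · rw [mem_Icc] at hh ⊢; omega
  · rw [mem_Icc] at hk ⊢; omega
  · rw [mem_Icc] at hh; omega
  · rw [mem_Icc] at hk; omega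
  · rw [mem_Icc] at hh
    have hcast : ((e - h : ℕ) : ℤ) = (e : ℤ) - h := by push_cast [Nat.cast_sub (by omega : h ≤ e)]; ring
    rw [hcast, show -((e : ℤ) - h) = (h : ℤ) - e by ring, ← hper ((h : ℤ) - e), sub_add_cancel]

/-- The summand of the trilinear form is `e`-periodic in `h` through `S^{(b)}` : `S^{(b)}_g(h + e; e) = S^{(b)}_g(h; e)`.
[this work] -/
theorem hooleySumShift_add_modulus_freq (g : ℤ[X]) (e : ℕ) (h b : ℤ) :
    hooleySumShift g e (h + e) b = hooleySumShift g e h b := by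
  rw [hooleySumShift_eq_sum, hooleySumShift_eq_sum]
  refine sum_congr rfl fun ν _ => ?_
  rw [show (h + e) * ((ν : ℤ) - b) = h * ((ν : ℤ) - b) + e * ((ν : ℤ) - b) by ring, eAdd_add_modulus_mul]

/-! ### The folded trilinear form with `|κ| ≤ 1/(4|h|)` -/

/-- The `(e, h)` summand of the exact trilinear identity `polySmoothMid_sub_heur_eq_shift`. [this work] -/
noncomputable def trilinearTerm (g : ℤ[X]) (Δ : ℝ) (x e : ℕ) (h : ℤ) : ℂ :=
  (1 / ((e : ℂ) * (eAdd e (-h) - 1)))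
    * ((locWeight g Δ e x : ℂ) * hooleySumShift g e h ((x : ℤ) + 1)
        - (locWeight g Δ e 1 : ℂ) * hooleySumShift g e h 1
        - ∑ m ∈ Ico 1 x, ((locWeight g Δ e (m + 1) - locWeight g Δ e m : ℝ) : ℂ)
            * hooleySumShift g e h ((m : ℤ) + 1))

/-- `D_g(x) = ∑_{x<e≤E} ∑_{0<h<e} trilinearTerm g Δ x e h` (`x ≥ 1`, `g ≠ 0` on `[1,x]`, `E ≥ max|g(n)|`). [this work] -/
theorem polySmoothMid_sub_heur_eq_sum_trilinearTerm (g : ℤ[X]) (Δ : ℝ) {x E : ℕ} (hx : 1 ≤ x)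
    (hg0 : ∀ n ∈ Icc 1 x, g.eval (n : ℤ) ≠ 0) (hE : ∀ n ∈ Icc 1 x, (g.eval (n : ℤ)).natAbs ≤ E) :
    ((polySmoothMid g Δ x : ℝ) : ℂ) - ((polySmoothHeur g Δ x E : ℝ) : ℂ)
      = ∑ e ∈ Ioc x E, ∑ h ∈ Ico 1 e, trilinearTerm g Δ x e h :=
  polySmoothMid_sub_heur_eq_shift g Δ hx hg0 hE

/-- The summand is `e`-periodic in `h`. [this work] -/
theorem trilinearTerm_add_modulus (g : ℤ[X]) (Δ : ℝ) (x e : ℕ) (h : ℤ) :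
    trilinearTerm g Δ x e (h + e) = trilinearTerm g Δ x e h := by
  unfold trilinearTerm
  rw [show -(h + (e : ℤ)) = -h + e * (-1) by ring, eAdd_add_modulus_mul]
  simp only [hooleySumShift_add_modulus_freq]

/-- **THE FOLDED EXACT IDENTITY**: `D_g(x) = ∑_{x<e≤E} (∑_{1≤h≤(e−1)/2} + ∑_{h=−k, 1≤k≤e/2}) trilinearTerm g Δ x e h`
— all frequencies now satisfy `0 < |h| ≤ e/2`. [this work] -/
theorem polySmoothMid_sub_heur_eq_fold (g : ℤ[X]) (Δ : ℝ) {x E : ℕ} (hx : 1 ≤ x)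
    (hg0 : ∀ n ∈ Icc 1 x, g.eval (n : ℤ) ≠ 0) (hE : ∀ n ∈ Icc 1 x, (g.eval (n : ℤ)).natAbs ≤ E) :
    ((polySmoothMid g Δ x : ℝ) : ℂ) - ((polySmoothHeur g Δ x E : ℝ) : ℂ)
      = ∑ e ∈ Ioc x E, (∑ h ∈ Icc 1 ((e - 1) / 2), trilinearTerm g Δ x e h
          + ∑ k ∈ Icc 1 (e / 2), trilinearTerm g Δ x e (-(k : ℤ))) := by
  rw [polySmoothMid_sub_heur_eq_sum_trilinearTerm g Δ hx hg0 hE]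
  exact sum_congr rfl fun e _ => sum_Ico_eq_sum_fold _ (trilinearTerm_add_modulus g Δ x e)

/-- `‖e(k/q) − 1‖ = ‖e(−k/q) − 1‖`. [folklore] -/
theorem norm_eAdd_sub_one_eq_neg (q : ℕ) (k : ℤ) : ‖eAdd q k - 1‖ = ‖eAdd q (-k) - 1‖ := by
  have h : eAdd q (-k) * (eAdd q k - 1) = -(eAdd q (-k) - 1) := by
    rw [mul_sub, ← eAdd_add, neg_add_cancel, eAdd_zero, mul_one, neg_sub]
  have h2 := congrArg (‖·‖) h
  simp only [norm_mul, norm_eAdd, one_mul, norm_neg] at h2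
  exact h2

/-- **After folding, `|κ_e(h)| ≤ 1/(4h)`** for `1 ≤ h ≤ e/2`. [this work] -/
theorem norm_modulusWeight_le_of_two_mul_le {e h : ℕ} (h0 : 0 < h) (h2 : 2 * h ≤ e) :
    ‖1 / ((e : ℂ) * (eAdd e (-(h : ℤ)) - 1))‖ ≤ 1 / (4 * (h : ℝ)) := by
  have h1 := norm_modulusWeight_le h0 (by omega : h < e)
  rwa [min_eq_left (by omega : h ≤ e - h)] at h1

/-- **After folding, `|κ_e(−k)| ≤ 1/(4k)`** for `1 ≤ k ≤ e/2`. [this work] -/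
theorem norm_modulusWeight_neg_le_of_two_mul_le {e k : ℕ} (h0 : 0 < k) (h2 : 2 * k ≤ e) :
    ‖1 / ((e : ℂ) * (eAdd e (-(-(k : ℤ))) - 1))‖ ≤ 1 / (4 * (k : ℝ)) := by
  have h1 := norm_modulusWeight_le_of_two_mul_le h0 h2
  rw [norm_div, norm_mul, norm_eAdd_sub_one_eq_neg] at h1 ⊢
  rw [neg_neg] at h1 ⊢
  rwa [norm_eAdd_sub_one_eq_neg] at h1

/-! ### The recorded target -/

/-- **TARGET (NOT PROVED — recorded for the programme's annex).**  For `g` irreducible of degree `d ≥ 3`: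
every uniform power saving `η > 1 − 2/d` in the shifted Hooley sums gives window root equidistribution, hence
Erdős's asymptotic `∑_{n≤x} τ(|g(n)|) ~ d·A_g·x log x`.  Meaningful for `d = 3` (`η > 1/3`); for `d ≥ 4` the
required saving is at or beyond square root.  The route: `windowRootEquidistribution_iff_smooth`, the exact
folded trilinear identity `polySmoothMid_sub_heur_eq_fold` (`|κ_e(h)| ≤ 1/(4|h|)`), and Abel summation in `e`
(`norm_sum_weight_mul_hooleySumShift_le`) on the dyadic blocks carrying `Δa_e(m)`. [this work] -/
def HooleyShiftTarget (g : ℤ[X]) : Prop :=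
  ∀ η : ℝ, 1 - 2 / (g.natDegree : ℝ) < η → HooleyShiftUniform g η → WindowRootEquidistribution g

/-- The target in Erdős's terms: `HooleyShiftTarget g` says that a saving `η > 1 − 2/d` yields
`ErdosDivisorSumAsymptotic g` (`g` irreducible, `d ≥ 2`). [this work] -/
theorem erdosDivisorSumAsymptotic_of_target {g : ℤ[X]} (hirr : Irreducible g) (hdeg : 2 ≤ g.natDegree)
    (hT : HooleyShiftTarget g) {η : ℝ} (hη : 1 - 2 / (g.natDegree : ℝ) < η) (hH : HooleyShiftUniform g η) :
    ErdosDivisorSumAsymptotic g :=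
  (erdosDivisorSumAsymptotic_iff_windowRootEquidistribution hirr hdeg).mpr (hT η hη hH)

end Summit.Parity.BatemanHorn.Theorems
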